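import Literature.IUT.HodgeTheaters.ThetaHodgeTheaters
import Literature.IUT.HodgeTheaters.ThetaHodgeTheatersWitness
import Literature.IUT.HodgeTheaters.HodgeTheaterModelFKitWitness
import HarnessLib

/-!
# Non-vacuity of `ThetaHodgeTheater.Iso` ([IUTchI] Remark 3.6.2: "an evident notion of isomorphism of Θ-Hodge theaters")

S. Mochizuki, *Inter-universal Teichmüller theory I*, §3, Definition 3.6 and Remark 3.6.2, kurims manuscript (May 2020)
p. 87 [claim: Mochizuki2012, status: disputed]. PROOF-ONLY companion (no definitions) to abc-iut-L5-t2's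
`ThetaHodgeTheaters.lean`, written for the L5 non-vacuity register (L5-lead RULINGS #27, row family `NV-L5/<Interface>`;
abc-iut-w5-d197's INHABITATION-CENSUS-L5 v1 lists `ThetaHodgeTheater.Iso` among the `[hom]` rows with ZERO producers).

What is certified here, for EVERY initial Θ-datum `D`, EVERY model `M : HodgeTheaterModel D` of the §3 interface and
EVERY Θ-Hodge theater over it:

* `ThetaHodgeTheater.Iso.nonempty_refl` — the identity isomorphism exists (generic; the compatibility square of
  Rmk 3.6.2 holds for identities by functoriality), and `nonempty_symm` / `nonempty_trans` — "being isomorphic" is an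
  equivalence relation (`ThetaHodgeTheater.Iso.nonempty_equivalence`), as an "evident notion of isomorphism" must be;
* `ThetaHodgeTheater.Iso.exists_globIso_eq_of_full` — a SUFFICIENT condition for extending an isomorphism of the global
  data `†ℱ⊩_mod ⥲ ‡ℱ⊩_mod` to an isomorphism of Θ-Hodge theaters: the constructions `ℱ̲_v ↦ ℱ⊢_v` are full functors
  (then the local components are chosen as preimages; no claim that print's model has this property);
* at the in-tree producers of the object type: the reference theater `ThetaHodgeTheater.ref M` (every `M`), the
  TRIVIAL model `HodgeTheaterModel.trivial D` of abc-iut-L5-t2 (label `degenerate`: there every two theaters are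
  isomorphic and `Iso` is a subsingleton) and the UNITS model `HodgeTheaterModel.unitsModel D` of abc-iut-L5-t3
  (label `parameterRecord`/kit-rule inhabitant, kinds = the one-object groupoid on `ℤˣ`): there every two theaters are
  isomorphic AND the reference theater has a NON-identity automorphism (simultaneous sign change `−1`), so the notion
  is not degenerate-by-typing.

Honest labels (RULINGS #27 (c)): `_refl`/generic = model-agnostic identity; `_trivial` = degenerate; `_unitsModel` =
kit-rule parameter record. Nothing of [IUTchI] is asserted; instantiated ≠ endorsed; no side is taken on [IUTchIII]
Cor. 3.12.
-/

namespace Literature.IUT.HodgeTheaters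

open CategoryTheory

universe u v w uM

namespace ThetaHodgeTheater

variable {F : Type u} {K : Type v} {Fbar : Type w} [Field F] [NumberField F] [Field K]
  [NumberField K] [Algebra F K] [Field Fbar] [Algebra F Fbar] [Algebra K Fbar]
  {E : WeierstrassCurve F} [E.IsElliptic] {l : ℕ} {P : BadPlacePredicates K} {D : InitialThetaData F K Fbar E l P}

/-! ### Generic: identities, inverses, composites -/

section Generic

variable {M : HodgeTheaterModel D}

/-- **Rmk 3.6.2, identity**: every Θ-Hodge theater is isomorphic to itself — the identity isomorphisms of the
constituent data are compatible (functors preserve identities). Model-agnostic non-vacuity witness for the `[hom]` row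
`ThetaHodgeTheater.Iso`. ([IUTchI] Rmk 3.6.2 p. 87) [claim: Mochizuki2012, status: disputed] -/
theorem Iso.nonempty_refl (HT : ThetaHodgeTheater M) : Nonempty (Iso HT HT) :=
  ⟨{ locIso := fun _ => CategoryTheory.Iso.refl _
     globIso := CategoryTheory.Iso.refl _
     comm := fun v => by rw [Functor.mapIso_refl, Functor.mapIso_refl, Iso.refl_trans, Iso.trans_refl] }⟩

/-- **Rmk 3.6.2, inverses**: an isomorphism of Θ-Hodge theaters can be inverted (the compatibility squares of the
inverse isomorphisms commute). ([IUTchI] Rmk 3.6.2 p. 87) [claim: Mochizuki2012, status: disputed] -/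
theorem Iso.nonempty_symm {HT HT' : ThetaHodgeTheater M} (h : Nonempty (Iso HT HT')) : Nonempty (Iso HT' HT) := by
  obtain ⟨φ⟩ := h
  refine ⟨{ locIso := fun v => (φ.locIso v).symm, globIso := φ.globIso.symm, comm := fun v => ?_ }⟩
  have h := congrArg CategoryTheory.Iso.hom (φ.comm v)
  simp only [Iso.trans_hom, Functor.mapIso_hom] at h
  ext
  simp only [Iso.trans_hom, Functor.mapIso_hom, Iso.symm_hom]
  rw [← Functor.mapIso_inv, ← Functor.mapIso_inv, Iso.inv_comp_eq, ← Category.assoc, Iso.eq_comp_inv,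
    Functor.mapIso_hom, Functor.mapIso_hom, h]

/-- **Rmk 3.6.2, composites**: isomorphisms of Θ-Hodge theaters compose (the compatibility squares paste).
([IUTchI] Rmk 3.6.2 p. 87) [claim: Mochizuki2012, status: disputed] -/
theorem Iso.nonempty_trans {HT HT' HT'' : ThetaHodgeTheater M} (h : Nonempty (Iso HT HT'))
    (h' : Nonempty (Iso HT' HT'')) : Nonempty (Iso HT HT'') := by
  obtain ⟨φ⟩ := h
  obtain ⟨ψ⟩ := h'
  refine ⟨{ locIso := fun v => φ.locIso v ≪≫ ψ.locIso v, globIso := φ.globIso ≪≫ ψ.globIso,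
            comm := fun v => ?_ }⟩
  have h₁ := congrArg CategoryTheory.Iso.hom (φ.comm v)
  have h₂ := congrArg CategoryTheory.Iso.hom (ψ.comm v)
  simp only [Iso.trans_hom, Functor.mapIso_hom] at h₁ h₂
  ext
  simp only [Iso.trans_hom, Functor.mapIso_hom, Functor.map_comp, Category.assoc]
  rw [h₂, reassoc_of% h₁]

/-- **Rmk 3.6.2**: "isomorphic as Θ-Hodge theaters" is an equivalence relation on the Θ-Hodge theaters over a model
of the §3 interface — the expected sanity property of an "evident notion of isomorphism".
([IUTchI] Rmk 3.6.2 p. 87) [claim: Mochizuki2012, status: disputed] -/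
theorem Iso.nonempty_equivalence : Equivalence fun HT HT' : ThetaHodgeTheater M => Nonempty (Iso HT HT') :=
  ⟨Iso.nonempty_refl, fun h => Iso.nonempty_symm h, fun h h' => Iso.nonempty_trans h h'⟩

/-- In particular the reference Θ-Hodge theater `ThetaHodgeTheater.ref M` (the in-tree producer of the object type,
implicit in Def. 3.6) has an automorphism, for every model `M` of the interface over every initial Θ-datum.
([IUTchI] Def 3.6 p. 87) [claim: Mochizuki2012, status: disputed] -/
theorem Iso.nonempty_ref (M : HodgeTheaterModel D) : Nonempty (Iso (ref M) (ref M)) :=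
  Iso.nonempty_refl (ref M)

/-- **A sufficient condition for extending isomorphisms of global data** (Rmk 3.6.2 / Rmk 3.5.2 (i): an isomorphism
is a COMPATIBLE system of isomorphisms of the constituents): if each construction `ℱ̲_v ↦ ℱ⊢_v` (`M.dashOf v`) is a
full functor, then every isomorphism `†ℱ⊩_mod ⥲ ‡ℱ⊩_mod` is the global component of an isomorphism of Θ-Hodge
theaters — the local components are preimages of the isomorphisms `†ℱ⊢_v ⥲ ‡ℱ⊢_v` it induces on `v̲`-components. A
hypothesis on the MODEL, not a claim about print's Examples 3.2–3.5. ([IUTchI] Rmk 3.6.2 p. 87) [claim: Mochizuki2012, status: disputed] -/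
theorem Iso.exists_globIso_eq_of_full [∀ v, (M.dashOf v).Full] (HT HT' : ThetaHodgeTheater M)
    (g : HT.glob ≅ HT'.glob) : ∃ φ : Iso HT HT', φ.globIso = g := by
  let k : ∀ v, (M.dashOf v).obj (HT.loc v) ≅ (M.dashOf v).obj (HT'.loc v) := fun v =>
    (HT.component_iso v).symm ≪≫ (M.component v).mapIso g ≪≫ HT'.component_iso v
  refine ⟨{ locIso := fun v => (Groupoid.isoEquivHom _ _).symm ((M.dashOf v).preimage (k v).hom)
            globIso := g
            comm := fun v => ?_ }, rfl⟩
  ext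
  simp only [Iso.trans_hom, Functor.mapIso_hom, Groupoid.isoEquivHom, Equiv.coe_fn_symm_mk,
    Functor.map_preimage, k, Iso.symm_hom, Iso.hom_inv_id_assoc]

end Generic

/-! ### At the trivial model of abc-iut-L5-t2 (`HodgeTheaterModel.trivial D`; label: degenerate) -/

section Trivial

/-- Over the TRIVIAL model (every kind of data the one-object discrete groupoid) any two Θ-Hodge theaters are
isomorphic — degenerate witness, recorded only as "the type is inhabited over a closed term".
([IUTchI] Rmk 3.6.2 p. 87) [claim: Mochizuki2012, status: disputed] -/
theorem Iso.nonempty_trivial (D : InitialThetaData F K Fbar E l P)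
    (HT HT' : ThetaHodgeTheater (HodgeTheaterModel.trivial D)) : Nonempty (Iso HT HT') :=
  ⟨{ locIso := fun _ => eqToIso (Subsingleton.elim _ _)
     globIso := eqToIso (Subsingleton.elim _ _)
     comm := fun _ => Subsingleton.elim _ _ }⟩

/-- … and over the trivial model the isomorphisms between two Θ-Hodge theaters form a subsingleton (this model
IS degenerate: compare `Iso.exists_globIso_ne_refl_unitsModel`). ([IUTchI] Rmk 3.6.2 p. 87) [claim: Mochizuki2012, status: disputed] -/
theorem Iso.subsingleton_trivial (D : InitialThetaData F K Fbar E l P)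
    (HT HT' : ThetaHodgeTheater (HodgeTheaterModel.trivial D)) : Subsingleton (Iso HT HT') := by
  refine ⟨fun φ ψ => ?_⟩
  have hl : φ.locIso = ψ.locIso := funext fun _ => Subsingleton.elim _ _
  have hg : φ.globIso = ψ.globIso := Subsingleton.elim _ _
  cases φ; cases ψ; cases hl; cases hg; rfl

end Trivial

/-! ### At the units model of abc-iut-L5-t3 (`HodgeTheaterModel.unitsModel D`; label: kit-rule parameter record) -/

section Units

/-- Over the UNITS model of abc-iut-L5-t3 (every kind the one-object groupoid on `{±1} = ℤˣ`, all constructions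
identity functors — in particular `ℱ̲_v ↦ ℱ⊢_v` is full) any two Θ-Hodge theaters are isomorphic: extend any
isomorphism of the global data (Def. 3.6 (c) supplies one through `ℱ⊩_mod`). ([IUTchI] Rmk 3.6.2 p. 87) [claim: Mochizuki2012, status: disputed] -/
theorem Iso.nonempty_unitsModel (D : InitialThetaData F K Fbar E l P)
    (HT HT' : ThetaHodgeTheater (HodgeTheaterModel.unitsModel D)) : Nonempty (Iso HT HT') := by
  obtain ⟨e⟩ := HT.glob_iso
  obtain ⟨e'⟩ := HT'.glob_iso
  haveI : ∀ x, ((HodgeTheaterModel.unitsModel D).dashOf x).Full := fun _ => Functor.Full.id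
  obtain ⟨φ, -⟩ := Iso.exists_globIso_eq_of_full HT HT' (e ≪≫ e'.symm)
  exact ⟨φ⟩

/-- The automorphism `−1` of the object of the one-object groupoid on `ℤˣ` (Mathlib plumbing for the units model).
[folklore] -/
private theorem exists_iso_hom_eq_neg_one :
    ∃ g : (SingleObj.star ℤˣ : SingleObj ℤˣ) ≅ SingleObj.star ℤˣ, g.hom = (-1 : ℤˣ) :=
  ⟨(Groupoid.isoEquivHom _ _).symm (-1 : ℤˣ), rfl⟩

/-- **The notion is not degenerate-by-typing**: over the units model the reference Θ-Hodge theater has an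
automorphism whose global component `ℱ⊩_mod ⥲ ℱ⊩_mod` is NOT the identity (it is `−1`; its local components are then
forced to be `−1` by the compatibility of Rmk 3.6.2). Kit-rule parameter record of abc-iut-L5-t3, not print's model.
([IUTchI] Rmk 3.6.2 p. 87) [claim: Mochizuki2012, status: disputed] -/
theorem Iso.exists_globIso_ne_refl_unitsModel (D : InitialThetaData F K Fbar E l P) :
    ∃ φ : Iso (ref (HodgeTheaterModel.unitsModel D)) (ref (HodgeTheaterModel.unitsModel D)),
      φ.globIso ≠ CategoryTheory.Iso.refl _ := by
  haveI : ∀ x, ((HodgeTheaterModel.unitsModel D).dashOf x).Full := fun _ => Functor.Full.id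
  obtain ⟨g, hg⟩ := exists_iso_hom_eq_neg_one
  obtain ⟨φ, hφ⟩ := Iso.exists_globIso_eq_of_full (ref (HodgeTheaterModel.unitsModel D))
    (ref (HodgeTheaterModel.unitsModel D)) g
  refine ⟨φ, fun h => ?_⟩
  have h1 : ((-1 : ℤˣ) : ℤˣ) = (1 : ℤˣ) := by rw [← hg, ← hφ, h]; rfl
  exact absurd h1 (by decide)

/-- Hence over the units model the automorphisms of the reference Θ-Hodge theater do NOT form a subsingleton
(contrast `Iso.subsingleton_trivial`). ([IUTchI] Rmk 3.6.2 p. 87) [claim: Mochizuki2012, status: disputed] -/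
theorem Iso.not_subsingleton_unitsModel (D : InitialThetaData F K Fbar E l P) :
    ¬ Subsingleton (Iso (ref (HodgeTheaterModel.unitsModel D)) (ref (HodgeTheaterModel.unitsModel D))) := by
  intro hsub
  obtain ⟨φ, hφ⟩ := Iso.exists_globIso_ne_refl_unitsModel D
  obtain ⟨ρ⟩ := Iso.nonempty_refl (ref (HodgeTheaterModel.unitsModel D))
  haveI : ∀ x, ((HodgeTheaterModel.unitsModel D).dashOf x).Full := fun _ => Functor.Full.id
  obtain ⟨ψ, hψ⟩ := Iso.exists_globIso_eq_of_full (ref (HodgeTheaterModel.unitsModel D))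
    (ref (HodgeTheaterModel.unitsModel D)) (CategoryTheory.Iso.refl _)
  exact hφ ((congrArg Iso.globIso (hsub.elim φ ψ)).trans hψ)

end Units

end ThetaHodgeTheater

end Literature.IUT.HodgeTheaters
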